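import Mathlib.Tactic
import HarnessLib

/-!
# S2β · D-GUARD ∕ (BG∞) — THE MONOTONE STRETCH ((R1) of FINDING (BX): the blocks of `hSec` are boxes `{c, c+1}³`, not cubes; rectangles∕boxes reduce to the
# landed squares∕cubes (T2 ✓p839841, S2 ✓p839993) by reparametrising the short side(s) monotonically onto the long one)

Cell `ym3-torus` (YM ladder rung R3 = continuum `SU(2)` Yang–Mills on the three-torus at fixed lattice data — a RUNG: NOT d = 4, NOT infinite volume,
NOT a mass gap, NOT Clay).  Width seat «width 5» `ym3-torus-px5` (gen 24), FREE px helper on crux `stmt-QuantumFields-20520` (`FluctuationComparisonRegPrIntL`;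
registry `Lines/semiclassical_s2beta.lean` UNTOUCHED, 0∕5); `--kind proof --supports stmt-QuantumFields-20520 --as helper`, count-neutral, DEFINITION-FREE
(0 `def`, 0 `instance`, 0 `notation`, 0 `sorry`, default heartbeats).  Pure `ℕ`.

WHY.  For `b ≤ a ≤ 2b` (`b ≥ 1`; the sides `c ≤ c + 1 ≤ 2c` of ✓`exists_parityBlocks`' boxes) the COMPRESSION `σ j := j·b ∕ a` (`{0..a} → {0..b}`, monotone, unit
steps, endpoints to endpoints) and the STRETCH `τ j := ⌈j·a ∕ b⌉ = (j·a + (b − 1)) ∕ b` (`{0..b} → {0..a}`, monotone, steps `≤ 2`, endpoints to endpoints,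
`σ ∘ τ = id`) transport ring∕shell data of a rectangle∕box to the square∕cube (`ψ (i, j) := φ (i, σ j)`) and the square∕cube filling back (`W φ (i, j′) :=
Wsq ψ (i, τ j′)`): boundary agreement by `σ (τ j′) = j′` and the endpoint laws, per-bond oscillation preserved by the unit steps of `σ`, lattice steps at most
doubled by the steps `≤ 2` of `τ` ((R2) «cone on a discrete rectangle», (L-T)′, and px8's box version of S2∕(L-S)).

WHAT IS PROVED (sorry-free): §1 the eleven laws of `σ`, `τ` as separate lemmas on the explicit formulas; §2 ★★★ `exists_stretch (a b) (hb : 1 ≤ b) (hba : b ≤ a)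
(hab : a ≤ 2·b) : ∃ σ τ : ℕ → ℕ, σ 0 = 0 ∧ σ a = b ∧ (monotone) ∧ (σ (j+1) ≤ σ j + 1) ∧ (j ≤ a → σ j ≤ b) ∧ τ 0 = 0 ∧ τ b = a ∧ (monotone) ∧ (τ (j+1) ≤ τ j + 2) ∧
(j ≤ b → τ j ≤ a) ∧ (∀ j, σ (τ j) = j)`.

HONEST SCOPE.  Elementary arithmetic; no lattice gauge theory; nothing of Bałaban's renormalisation-group analysis is asserted or proved ([Balaban1985RegularSpaces] Thm 2
p.83 is the consumer's context only).  `hSec` ∕ (BG∞) ∕ `hsupp⁺` are CONJECTURES (plan §116) and NOT proved; GAP♯∘ (registry UNTOUCHED), the five registered stubs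
(0∕5), S2β, 20520, 19936, 19200, `YM3TorusSU2` are NOT proved; no registered stub is closed; rung R3 — NOT d = 4, NOT infinite volume, NOT a mass gap, NOT Clay;
the Yang–Mills mass gap is NOT proved.  Axioms standard.

References: T. Bałaban, CMP **99** (1985) 75–102 [Balaban1985RegularSpaces] (Thm 2 p.83).
-/

set_option autoImplicit false

namespace Summit.QuantumFields.YangMills.Theorems.FluctuationComparisonRegPrIntLS2BetaMonotoneStretch

/-! ## §1 The laws of `σ j = j·b ∕ a` and `τ j = (j·a + (b − 1)) ∕ b` -/

/-- `σ 0 = 0`. [folklore] -/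
theorem compress_zero (a b : ℕ) : 0 * b / a = 0 := by simp

/-- `σ a = b` (`a ≥ 1`). [folklore] -/
theorem compress_end (a b : ℕ) (ha : 0 < a) : a * b / a = b := Nat.mul_div_cancel_left b ha

/-- `σ` is monotone. [folklore] -/
theorem compress_mono (a b j : ℕ) : j * b / a ≤ (j + 1) * b / a :=
  Nat.div_le_div_right (Nat.mul_le_mul_right b (Nat.le_succ j))

/-- `σ` has unit steps (`b ≤ a`). [folklore] -/
theorem compress_step (a b j : ℕ) (ha : 0 < a) (hba : b ≤ a) : (j + 1) * b / a ≤ j * b / a + 1 := by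
  have h : (j + 1) * b ≤ j * b + a := by rw [Nat.succ_mul]; omega
  calc (j + 1) * b / a ≤ (j * b + a) / a := Nat.div_le_div_right h
    _ = j * b / a + 1 := Nat.add_div_right _ ha

/-- `σ j ≤ b` for `j ≤ a`. [folklore] -/
theorem compress_le (a b j : ℕ) (ha : 0 < a) (hj : j ≤ a) : j * b / a ≤ b := by
  calc j * b / a ≤ a * b / a := Nat.div_le_div_right (Nat.mul_le_mul_right b hj)
    _ = b := compress_end a b ha

/-- `τ 0 = 0` (`b ≥ 1`). [folklore] -/
theorem stretch_zero (a b : ℕ) (hb : 0 < b) : (0 * a + (b - 1)) / b = 0 := by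
  rw [zero_mul, zero_add]
  exact Nat.div_eq_of_lt (by omega)

/-- `τ b = a` (`b ≥ 1`). [folklore] -/
theorem stretch_end (a b : ℕ) (hb : 0 < b) : (b * a + (b - 1)) / b = a := by
  rw [Nat.mul_add_div hb, Nat.div_eq_of_lt (by omega), add_zero]

/-- `τ` is monotone. [folklore] -/
theorem stretch_mono (a b j : ℕ) : (j * a + (b - 1)) / b ≤ ((j + 1) * a + (b - 1)) / b :=
  Nat.div_le_div_right (by rw [Nat.succ_mul]; omega)

/-- `τ` has steps `≤ 2` (`a ≤ 2b`, `b ≥ 1`). [folklore] -/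
theorem stretch_step (a b j : ℕ) (hb : 0 < b) (hab : a ≤ 2 * b) : ((j + 1) * a + (b - 1)) / b ≤ (j * a + (b - 1)) / b + 2 := by
  have h : (j + 1) * a + (b - 1) ≤ j * a + (b - 1) + 2 * b := by rw [Nat.succ_mul]; omega
  calc ((j + 1) * a + (b - 1)) / b ≤ (j * a + (b - 1) + 2 * b) / b := Nat.div_le_div_right h
    _ = (j * a + (b - 1)) / b + 2 := Nat.add_mul_div_right _ _ hb

/-- `τ j ≤ a` for `j ≤ b` (`b ≥ 1`). [folklore] -/
theorem stretch_le (a b j : ℕ) (hb : 0 < b) (hj : j ≤ b) : (j * a + (b - 1)) / b ≤ a := by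
  calc (j * a + (b - 1)) / b ≤ (b * a + (b - 1)) / b := Nat.div_le_div_right (by nlinarith)
    _ = a := stretch_end a b hb

/-- The stretch lands in the fibre: `j·a ≤ τ j · b ≤ j·a + (b − 1)`. [folklore] -/
theorem stretch_mul_bounds (a b j : ℕ) (hb : 0 < b) :
    j * a ≤ (j * a + (b - 1)) / b * b ∧ (j * a + (b - 1)) / b * b ≤ j * a + (b - 1) := by
  have h1 := Nat.div_mul_le_self (j * a + (b - 1)) b
  have h2 := Nat.mod_add_div (j * a + (b - 1)) b
  have h3 := Nat.mod_lt (j * a + (b - 1)) hb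
  constructor
  · have : (j * a + (b - 1)) / b * b = b * ((j * a + (b - 1)) / b) := Nat.mul_comm _ _
    omega
  · exact h1

/-- `σ ∘ τ = id` (`1 ≤ b ≤ a`). [folklore] -/
theorem compress_stretch (a b j : ℕ) (hb : 0 < b) (hba : b ≤ a) : (j * a + (b - 1)) / b * b / a = j := by
  obtain ⟨hlo, hhi⟩ := stretch_mul_bounds a b j hb
  have ha : 0 < a := by omega
  refine Nat.div_eq_of_lt_le hlo ?_
  calc (j * a + (b - 1)) / b * b ≤ j * a + (b - 1) := hhi
    _ < (j + 1) * a := by rw [Nat.succ_mul]; omega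

/-! ## §2 The packaged pair -/

/-- ★★★ **THE MONOTONE STRETCH**: for `1 ≤ b ≤ a ≤ 2b` there are `σ τ : ℕ → ℕ` with `σ 0 = 0`, `σ a = b`, `σ` monotone with unit steps and `σ j ≤ b` on `{0..a}`;
`τ 0 = 0`, `τ b = a`, `τ` monotone with steps `≤ 2` and `τ j ≤ a` on `{0..b}`; and `σ (τ j) = j` (`σ j := j·b∕a`, `τ j := ⌈j·a∕b⌉`). [folklore] -/
theorem exists_stretch (a b : ℕ) (hb : 1 ≤ b) (hba : b ≤ a) (hab : a ≤ 2 * b) :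
    ∃ σ τ : ℕ → ℕ,
      σ 0 = 0 ∧ σ a = b ∧ (∀ j, σ j ≤ σ (j + 1)) ∧ (∀ j, σ (j + 1) ≤ σ j + 1) ∧ (∀ j, j ≤ a → σ j ≤ b) ∧
      τ 0 = 0 ∧ τ b = a ∧ (∀ j, τ j ≤ τ (j + 1)) ∧ (∀ j, τ (j + 1) ≤ τ j + 2) ∧ (∀ j, j ≤ b → τ j ≤ a) ∧
      (∀ j, σ (τ j) = j) := by
  have ha : 0 < a := by omega
  have hb0 : 0 < b := hb
  exact ⟨fun j => j * b / a, fun j => (j * a + (b - 1)) / b,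
    compress_zero a b, compress_end a b ha, fun j => compress_mono a b j, fun j => compress_step a b j ha hba,
    fun j hj => compress_le a b j ha hj,
    stretch_zero a b hb0, stretch_end a b hb0, fun j => stretch_mono a b j, fun j => stretch_step a b j hb0 hab,
    fun j hj => stretch_le a b j hb0 hj, fun j => compress_stretch a b j hb0 hba⟩

end Summit.QuantumFields.YangMills.Theorems.FluctuationComparisonRegPrIntLS2BetaMonotoneStretch
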